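import Summits.RiemannHypothesis.RiemannHypothesis.Theorems.SemilocalDeletionToeplitzFloor
import HarnessLib

/-!
# The Toeplitz floor with TWO certificates: a CONFINEMENT LAW for the prime-deletion cliff

`SemilocalDeletionToeplitzFloor.lean` (p374808) bounds the whole deletion perturbation of one prime `p` with `m+1` visible
powers on `[−c, c]` by ONE fibre certificate `A_{m+1}(p) + μ·I ⪰ 0`:  `Re Q_{S∖p}(g) ≥ Re Q_S(g) − μ‖g‖₂²`.  Its proof
cuts the base cell `I₀ = [−c, −c+L)` (`L = log p`) into fibres `v ↦ (g(v + iL))_{i ≤ m+1}`; but the LAST translate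
`v + (m+1)L` lies inside the window only for `v ≤ c − (m+1)L` ("full fibres", total length `2c − (m+1)L` = twice the ROOM);
on the remaining "partial fibres" `v ∈ (c − (m+1)L, −c + L)` the fibre vector has only `m+1` live entries, so the SMALLER
matrix `A_m(p)` — whose best constant `μ' = −λ_min(A_m(p)) < μ = −λ_min(A_{m+1}(p))` — applies there.  Hence (§1):

* `re_weilSemilocalQuadratic_erase_ge_of_two_certs` — **TWO-CERTIFICATE FLOOR**:
  `Re Q_{S∖p}(g) ≥ Re Q_S(g) − μ‖g‖₂² + (μ − μ')·M_part(g)`,  `M_part(g) = Σ_{i ≤ m} ∫_{(c−(m+1)L, −c+L)} |g(v + iL)|² dv`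
  (written out as this finite sum of set integrals in every statement) = the `L²`-mass of `g` on the PARTIAL fibres
  (the `m+1` strips of length `(m+2)L − 2c` preceding each new cell boundary).

and the corollaries (§2), valid for EVERY finite `S ∋ p`, every window and every constraint `P`:

* `partialMass_le_of_two_certs` — **CONFINEMENT LAW (Rayleigh form)**: `(μ − μ')·M_part(g) ≤ Re Q_{S∖p}(g) − Re Q_S(g) + μ‖g‖₂²`;
* `partialMass_le_excess` — for `‖g‖₂ = 1`, `P g`:  `(μ − μ')·M_part(g) ≤ Re Q_{S∖p}(g) − (λ_min(S; c; P) − μ)` — a test function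
  whose deleted Rayleigh quotient is within `η` of the Toeplitz floor `λ_min(S; c; P) − μ` carries at most `η/(μ − μ')` of its mass on
  the partial fibres;
* `partialMass_le_of_near_minimizer` — for an `η`-near-minimizer of the deleted form:
  `M_part(g) ≤ (λ_min(S∖p; c; P) − λ_min(S; c; P) + μ + η)/(μ − μ')` = (EXCESS over the floor + η)/(certificate gap).

THE LAW THESE ARE THE THEOREM SIDE OF (cc-s2-1 gen13, 2026-08-24; kit j217348 / j217393, HOME/cc-s2-1/gen13/ANATOMY-LAW.md):
in all 75 lineage-E cells `U(b)∖{p}` (`p = 2 … 13`, `2 … 8` visible powers) the excess `Δ` of the deleted bottom over the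
Toeplitz floor is 79–100 % FIBRE SLACK — mass `θ` leaked onto the partial fibres times the gap `μ − μ'`, plus pattern
misalignment — and at most ≈ 20 % window energy of the undeleted form; `θ·(μ − μ') ≤ Δ` in every cell, as
`partialMass_le_of_near_minimizer` demands (`η = 0`, `λ_min(U(b); b) ≥ 0`), with `θ(μ − μ')/Δ` from `1.00` (no room: the bottom
sits on the previous floor, `θ = 1`) down to `0.22` (room `0.27`, `p = 2`).  Nothing here bears on RH: statements about truncated forms.
-/

set_option linter.dupNamespace false

noncomputable section

open Complex Filter Set MeasureTheory
open scoped Real Topology ComplexConjugate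

namespace Summit.RiemannHypothesis.RiemannHypothesis.Theorems.SemilocalDeletionToeplitzConfinement

open Literature.NumberTheory.LFunctions
open Summit.RiemannHypothesis.RiemannHypothesis.Theorems.SemilocalDeletionCliff
open Summit.RiemannHypothesis.RiemannHypothesis.Theorems.SemilocalDeletionToeplitzFloor
open Summit.RiemannHypothesis.RiemannHypothesis.Theorems.HandoffSemilocalEnergy

variable {g : ℝ → ℂ}

/-! ## §1  The two-certificate floor -/

/-- **TWO-CERTIFICATE TOEPLITZ FLOOR.** Let `p ∈ S` be prime, `L = log p`, `tsupport g ⊆ [−c, c]` with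
`(m+1)L ≤ 2c < (m+2)L` (exactly the powers `p, …, p^{m+1}` are visible), `A_{m+1}(p) + μ I ⪰ 0` and `A_m(p) + μ' I ⪰ 0` (no order
between `μ` and `μ'` is needed; the interesting case is `μ' < μ`).  Then `Re Q_{S∖p}(g) ≥ Re Q_S(g) − μ‖g‖₂² + (μ − μ')·M_part(g)`: on the partial fibres only the smaller matrix acts,
so the mass parked there is charged `μ'` instead of `μ`. -/
theorem re_weilSemilocalQuadratic_erase_ge_of_two_certs (hg : IsWeilTest g) {S : Finset ℕ} {p : ℕ} (hp : p.Prime)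
    (hpS : p ∈ S) {c : ℝ} (hsupp : tsupport g ⊆ Icc (-c) c) {m : ℕ} (hm : 2 * c < (m + 2) * Real.log p)
    (hcm : (m + 1) * Real.log p ≤ 2 * c) {μ μ' : ℝ}
    (hcert : (∀ G : ℤ → ℂ, (∀ k : ℤ, k < 0 → G k = 0) → (∀ k : ℤ, ((m + 1 : ℕ) : ℤ) < k → G k = 0) →
      0 ≤ μ * ∑ i ∈ Finset.range (m + 2), ‖G i‖ ^ 2 +
        ∑ e ∈ Finset.range (m + 1), Real.log p / Real.sqrt ((p : ℝ) ^ (e + 1)) *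
          ∑ i ∈ Finset.range (m + 2), (G i * conj (G ((i : ℤ) - (e + 1))) + G i * conj (G ((i : ℤ) + (e + 1)))).re))
    (hcert' : (∀ G : ℤ → ℂ, (∀ k : ℤ, k < 0 → G k = 0) → (∀ k : ℤ, ((m : ℕ) : ℤ) < k → G k = 0) →
      0 ≤ μ' * ∑ i ∈ Finset.range (m + 1), ‖G i‖ ^ 2 +
        ∑ e ∈ Finset.range m, Real.log p / Real.sqrt ((p : ℝ) ^ (e + 1)) *
          ∑ i ∈ Finset.range (m + 1), (G i * conj (G ((i : ℤ) - (e + 1))) + G i * conj (G ((i : ℤ) + (e + 1)))).re)) :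
    (weilSemilocalQuadratic S g).re - μ * (∫ u : ℝ, ‖g u‖ ^ 2) + (μ - μ') * (∑ i ∈ Finset.range (m + 1),
        ∫ v in Ioo (c - (m + 1) * Real.log p) (-c + Real.log p), ‖g (v + i * Real.log p)‖ ^ 2) ≤
      (weilSemilocalQuadratic (S.erase p) g).re := by
  set L := Real.log p with hLdef
  have hL : 0 < L := Real.log_pos (by exact_mod_cast hp.one_lt)
  have hm' : 2 * c < ((m + 1 : ℕ) + 1) * Real.log p := by push_cast; linarith
  set k := weilConv g (weilReflect g) with hkdef
  set w : ℕ → ℝ := fun d ↦ Real.log p / Real.sqrt ((p : ℝ) ^ d) with hwdef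
  -- the perturbation and the deletion identity (m+1 visible powers)
  set Pz : ℂ := ∑ e ∈ Finset.range (m + 1), ((w (e + 1) : ℝ) : ℂ) * (k ((e + 1) * L) + k (-((e + 1) * L))) with hPdef
  have hid : weilSemilocalQuadratic (S.erase p) g = weilSemilocalQuadratic S g + Pz := by
    have h := weilSemilocalQuadratic_sub_erase_pow hg hp hpS hsupp hm'
    rw [← hkdef] at h
    linear_combination (-1 : ℂ) * h
  -- fibre integrands
  set I₀ := Ico (-c) (-c + L) with hI₀
  set T : ℕ → ℕ → ℝ → ℂ := fun e i v ↦
    g (v + i * L) * conj (g (v + i * L - (e + 1) * L)) + g (v + i * L) * conj (g (v + i * L + (e + 1) * L)) with hTdef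
  have hTi : ∀ e i, Integrable (T e i) := fun e i ↦ by
    have h1 := integrable_shift_mul_conj_shift hg (i * L) (i * L - (e + 1) * L)
    have h2 := integrable_shift_mul_conj_shift hg (i * L) (i * L + (e + 1) * L)
    have hT : T e i = (fun v ↦ g (v + i * L) * conj (g (v + (i * L - (e + 1) * L)))) +
        fun v ↦ g (v + i * L) * conj (g (v + (i * L + (e + 1) * L))) := by
      funext v
      simp only [hTdef, Pi.add_apply, add_sub_assoc, add_assoc]
    rw [hT]
    exact h1.add h2
  have hTre : ∀ e i, Integrable fun v ↦ (T e i v).re := fun e i ↦ (hTi e i).re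
  have hNi : ∀ i : ℕ, Integrable fun v : ℝ ↦ ‖g (v + i * L)‖ ^ 2 := fun i ↦
    hg.integrable_norm_sq.comp_add_right ((i : ℝ) * L)
  -- the partial-fibre indicator term
  set J := Ioi (c - (m + 1) * L) with hJ
  set Np : ℝ → ℝ := fun v ↦ ∑ i ∈ Finset.range (m + 1), ‖g (v + i * L)‖ ^ 2 with hNpdef
  have hNp : Integrable Np := integrable_finsetSum (Finset.range (m + 1)) fun i _ ↦ hNi i
  have hNpJ : Integrable (J.indicator Np) := hNp.indicator measurableSet_Ioi
  set Φ : ℝ → ℝ := fun v ↦ μ * ∑ i ∈ Finset.range (m + 2), ‖g (v + i * L)‖ ^ 2 - (μ - μ') * J.indicator Np v +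
    ∑ e ∈ Finset.range (m + 1), w (e + 1) * ∑ i ∈ Finset.range (m + 2), (T e i v).re with hΦdef
  -- (A) the fibre integral of Φ is μ‖g‖² − (μ − μ')·M_part + Re Pz
  have hnorm : ∫ u, ‖g u‖ ^ 2 = ∫ v in I₀, ∑ i ∈ Finset.range (m + 2), ‖g (v + i * L)‖ ^ 2 := by
    rw [integral_finsetSum (Finset.range (m + 2)) fun i _ ↦ (hNi i).integrableOn,
      integral_norm_sq_eq_sum_cells hg hsupp hL hm']
  have hpart : ∫ v in I₀, J.indicator Np v =
      ∑ i ∈ Finset.range (m + 1), ∫ v in Ioo (c - (m + 1) * L) (-c + L), ‖g (v + i * L)‖ ^ 2 := by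
    rw [setIntegral_indicator measurableSet_Ioi]
    have hIJ : I₀ ∩ J = Ioo (c - (m + 1) * L) (-c + L) := by
      ext v
      simp only [hI₀, hJ, mem_inter_iff, mem_Ico, mem_Ioi, mem_Ioo]
      constructor
      · rintro ⟨⟨_, h2⟩, h3⟩; exact ⟨h3, h2⟩
      · rintro ⟨h1, h2⟩; exact ⟨⟨by linarith, h2⟩, h1⟩
    rw [hIJ, integral_finsetSum (Finset.range (m + 1)) fun i _ ↦ (hNi i).integrableOn]
  have hP : Pz = ∑ e ∈ Finset.range (m + 1), ((w (e + 1) : ℝ) : ℂ) *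
      ∑ i ∈ Finset.range (m + 2), ∫ v in I₀, T e i v := by
    refine Finset.sum_congr rfl fun e _ ↦ ?_
    congr 1
    rw [hkdef, weilConv_weilReflect_eq_sum_cells hg hsupp hL hm', weilConv_weilReflect_eq_sum_cells hg hsupp hL hm',
      ← Finset.sum_add_distrib]
    refine Finset.sum_congr rfl fun i _ ↦ ?_
    rw [← integral_add]
    · refine setIntegral_congr_fun measurableSet_Ico fun v _ ↦ ?_
      simp only [hTdef, sub_neg_eq_add]
    · have := integrable_shift_mul_conj_shift hg (i * L) (i * L - (e + 1) * L)
      exact (this.congr (Eventually.of_forall fun v ↦ by rw [add_sub_assoc])).integrableOn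
    · have := integrable_shift_mul_conj_shift hg (i * L) (i * L + (e + 1) * L)
      exact (this.congr (Eventually.of_forall fun v ↦ by rw [sub_neg_eq_add, add_assoc])).integrableOn
  have hPre : Pz.re = ∫ v in I₀, ∑ e ∈ Finset.range (m + 1), w (e + 1) *
      ∑ i ∈ Finset.range (m + 2), (T e i v).re := by
    rw [hP, Complex.re_sum, integral_finsetSum _ fun e _ ↦ ?_]
    · refine Finset.sum_congr rfl fun e _ ↦ ?_
      rw [Complex.re_ofReal_mul, Complex.re_sum, integral_const_mul,
        integral_finsetSum (Finset.range (m + 2)) fun i _ ↦ (hTre e i).integrableOn]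
      congr 1
      refine Finset.sum_congr rfl fun i _ ↦ ?_
      have := integral_re ((hTi e i).integrableOn (s := I₀))
      simpa only [RCLike.re_to_complex] using this.symm
    · exact ((integrable_finsetSum (Finset.range (m + 2)) fun i _ ↦ hTre e i).const_mul (w (e + 1))).integrableOn
  have hA : ∫ v in I₀, Φ v = μ * (∫ u, ‖g u‖ ^ 2)
      - (μ - μ') * (∑ i ∈ Finset.range (m + 1), ∫ v in Ioo (c - (m + 1) * L) (-c + L), ‖g (v + i * L)‖ ^ 2)
      + Pz.re := by
    rw [hnorm, hPre, ← hpart, hΦdef, integral_add, integral_sub, integral_const_mul, integral_const_mul]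
    · exact ((integrable_finsetSum (Finset.range (m + 2)) fun i _ ↦ hNi i).const_mul μ).integrableOn
    · exact (hNpJ.const_mul (μ - μ')).integrableOn
    · exact (((integrable_finsetSum (Finset.range (m + 2)) fun i _ ↦ hNi i).const_mul μ).sub
        (hNpJ.const_mul (μ - μ'))).integrableOn
    · exact (integrable_finsetSum (Finset.range (m + 1)) fun e _ ↦
        (integrable_finsetSum (Finset.range (m + 2)) fun i _ ↦ hTre e i).const_mul (w (e + 1))).integrableOn
  -- (B) Φ ≥ 0 on the base cell: full fibres by `hcert`, partial fibres by `hcert'`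
  have hB : ∀ v ∈ I₀, 0 ≤ Φ v := by
    intro v hv
    rw [hI₀, mem_Ico] at hv
    set G : ℤ → ℂ := fun n ↦ g (v + n * L) with hGdef
    have hG1 : ∀ n : ℤ, n < 0 → G n = 0 := by
      intro n hn
      have hn' : (n : ℝ) ≤ -1 := by exact_mod_cast Int.le_sub_one_of_lt hn
      refine apply_eq_zero_of_not_mem hsupp fun h ↦ ?_
      rw [mem_Icc] at h
      nlinarith [h.1]
    have hG2 : ∀ n : ℤ, ((m + 1 : ℕ) : ℤ) < n → G n = 0 := by
      intro n hn
      have hn' : (m : ℝ) + 2 ≤ n := by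
        have : ((m + 1 : ℕ) : ℤ) + 1 ≤ n := Int.add_one_le_of_lt hn
        exact_mod_cast this
      refine apply_eq_zero_of_not_mem hsupp fun h ↦ ?_
      rw [mem_Icc] at h
      nlinarith [h.2]
    have hGi : ∀ i : ℕ, G i = g (v + i * L) := fun i ↦ by simp [hGdef]
    have hGm : ∀ i e : ℕ, G ((i : ℤ) - (e + 1)) = g (v + i * L - (e + 1) * L) := fun i e ↦ by
      simp only [hGdef]; push_cast; ring_nf
    have hGp : ∀ i e : ℕ, G ((i : ℤ) + (e + 1)) = g (v + i * L + (e + 1) * L) := fun i e ↦ by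
      simp only [hGdef]; push_cast; ring_nf
    -- the T-sums and norm sums in terms of G
    have hTG : ∀ e i : ℕ, (T e i v).re = (G i * conj (G ((i : ℤ) - (e + 1))) + G i * conj (G ((i : ℤ) + (e + 1)))).re := by
      intro e i; rw [hGi, hGm, hGp]
    have hNG : ∀ i : ℕ, ‖g (v + i * L)‖ ^ 2 = ‖G i‖ ^ 2 := fun i ↦ by rw [hGi]
    by_cases hvJ : v ∈ J
    · -- partial fibre: the last translate is outside the window, `G (m+1) = 0`
      rw [hJ, mem_Ioi] at hvJ
      have hGlast : G ((m + 1 : ℕ) : ℤ) = 0 := by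
        refine apply_eq_zero_of_not_mem hsupp fun h ↦ ?_
        rw [mem_Icc] at h
        have : v + ((m + 1 : ℕ) : ℤ) * L ≤ c := h.2
        push_cast at this
        linarith
      have hG2' : ∀ n : ℤ, (m : ℤ) < n → G n = 0 := by
        intro n hn
        rcases eq_or_lt_of_le (Int.add_one_le_of_lt hn) with h | h
        · rw [← h]; exact_mod_cast hGlast
        · exact hG2 n (by push_cast; linarith)
      have hc := hcert' G hG1 hG2'
      -- rewrite Φ v as the certificate expression of `hcert'`
      have hind : J.indicator Np v = ∑ i ∈ Finset.range (m + 1), ‖G i‖ ^ 2 := by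
        rw [Set.indicator_of_mem (show v ∈ J by rw [hJ, mem_Ioi]; exact hvJ), hNpdef]
        exact Finset.sum_congr rfl fun i _ ↦ hNG i
      have hsumN : ∑ i ∈ Finset.range (m + 2), ‖g (v + i * L)‖ ^ 2 = ∑ i ∈ Finset.range (m + 1), ‖G i‖ ^ 2 := by
        rw [Finset.sum_range_succ, hNG (m + 1), hGlast, norm_zero, zero_pow two_ne_zero, add_zero]
        exact Finset.sum_congr rfl fun i _ ↦ hNG i
      -- inner sums: the `i = m+1` summand vanishes
      have hinner : ∀ e : ℕ, ∑ i ∈ Finset.range (m + 2), (T e i v).re =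
          ∑ i ∈ Finset.range (m + 1), (G i * conj (G ((i : ℤ) - (e + 1))) + G i * conj (G ((i : ℤ) + (e + 1)))).re := by
        intro e
        rw [Finset.sum_range_succ, hTG e (m + 1), hGlast, zero_mul, zero_mul, add_zero, Complex.zero_re, add_zero]
        exact Finset.sum_congr rfl fun i _ ↦ hTG e i
      -- the top lag `e = m` couples only to dead entries
      have htop : ∑ i ∈ Finset.range (m + 1),
          (G i * conj (G ((i : ℤ) - (m + 1))) + G i * conj (G ((i : ℤ) + (m + 1)))).re = 0 := by
        refine Finset.sum_eq_zero fun i hi ↦ ?_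
        rw [Finset.mem_range] at hi
        have h1 : G ((i : ℤ) - (m + 1)) = 0 := by
          rcases lt_or_eq_of_le (show (i : ℤ) - (m + 1) ≤ 0 by omega) with h | h
          · exact hG1 _ h
          · -- i = m+1 impossible since i < m+1
            exfalso; omega
        have h2 : G ((i : ℤ) + (m + 1)) = 0 := hG2' _ (by omega)
        rw [h1, h2, map_zero, mul_zero, add_zero, Complex.zero_re]
      have hE : ∑ e ∈ Finset.range (m + 1), w (e + 1) * ∑ i ∈ Finset.range (m + 2), (T e i v).re =
          ∑ e ∈ Finset.range m, w (e + 1) *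
            ∑ i ∈ Finset.range (m + 1), (G i * conj (G ((i : ℤ) - (e + 1))) + G i * conj (G ((i : ℤ) + (e + 1)))).re := by
        rw [Finset.sum_range_succ (fun e ↦ w (e + 1) * ∑ i ∈ Finset.range (m + 2), (T e i v).re) m, hinner m, htop,
          mul_zero, add_zero]
        exact Finset.sum_congr rfl fun e _ ↦ by rw [hinner e]
      have hΦv : Φ v = μ' * ∑ i ∈ Finset.range (m + 1), ‖G i‖ ^ 2 +
          ∑ e ∈ Finset.range m, w (e + 1) *
            ∑ i ∈ Finset.range (m + 1), (G i * conj (G ((i : ℤ) - (e + 1))) + G i * conj (G ((i : ℤ) + (e + 1)))).re := by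
        simp only [hΦdef]
        rw [hind, hsumN, hE]
        ring
      rw [hΦv]
      simpa only [hwdef] using hc
    · -- full fibre: the certificate for `m+1` visible powers, indicator term zero
      have hc := hcert G hG1 hG2
      have hind : J.indicator Np v = 0 := Set.indicator_of_notMem hvJ _
      simp only [hGi, hGm, hGp] at hc
      have hΦv : Φ v = μ * ∑ i ∈ Finset.range (m + 2), ‖g (v + i * L)‖ ^ 2 +
          ∑ e ∈ Finset.range (m + 1), w (e + 1) * ∑ i ∈ Finset.range (m + 2), (T e i v).re := by
        simp only [hΦdef]; rw [hind, mul_zero, sub_zero]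
      rw [hΦv]
      simpa only [hTdef, hwdef] using hc
  have hpos : 0 ≤ ∫ v in I₀, Φ v := setIntegral_nonneg measurableSet_Ico hB
  rw [hid, Complex.add_re]
  linarith [hA ▸ hpos]

/-! ## §2  Confinement: near-floor functions live on the full fibres -/

/-- **CONFINEMENT LAW (Rayleigh form).** Under the two certificates: `(μ − μ')·M_part(g) ≤ Re Q_{S∖p}(g) − Re Q_S(g) + μ‖g‖₂²`
— the mass a test function parks on the partial fibres is paid for, at the rate of the certificate gap, by the excess of its
deleted form over the one-certificate Toeplitz floor. -/
theorem partialMass_le_of_two_certs (hg : IsWeilTest g) {S : Finset ℕ} {p : ℕ} (hp : p.Prime) (hpS : p ∈ S)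
    {c : ℝ} (hsupp : tsupport g ⊆ Icc (-c) c) {m : ℕ} (hm : 2 * c < (m + 2) * Real.log p)
    (hcm : (m + 1) * Real.log p ≤ 2 * c) {μ μ' : ℝ}
    (hcert : (∀ G : ℤ → ℂ, (∀ k : ℤ, k < 0 → G k = 0) → (∀ k : ℤ, ((m + 1 : ℕ) : ℤ) < k → G k = 0) →
      0 ≤ μ * ∑ i ∈ Finset.range (m + 2), ‖G i‖ ^ 2 +
        ∑ e ∈ Finset.range (m + 1), Real.log p / Real.sqrt ((p : ℝ) ^ (e + 1)) *
          ∑ i ∈ Finset.range (m + 2), (G i * conj (G ((i : ℤ) - (e + 1))) + G i * conj (G ((i : ℤ) + (e + 1)))).re))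
    (hcert' : (∀ G : ℤ → ℂ, (∀ k : ℤ, k < 0 → G k = 0) → (∀ k : ℤ, ((m : ℕ) : ℤ) < k → G k = 0) →
      0 ≤ μ' * ∑ i ∈ Finset.range (m + 1), ‖G i‖ ^ 2 +
        ∑ e ∈ Finset.range m, Real.log p / Real.sqrt ((p : ℝ) ^ (e + 1)) *
          ∑ i ∈ Finset.range (m + 1), (G i * conj (G ((i : ℤ) - (e + 1))) + G i * conj (G ((i : ℤ) + (e + 1)))).re)) :
    (μ - μ') * (∑ i ∈ Finset.range (m + 1),
        ∫ v in Ioo (c - (m + 1) * Real.log p) (-c + Real.log p), ‖g (v + i * Real.log p)‖ ^ 2) ≤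
      (weilSemilocalQuadratic (S.erase p) g).re - (weilSemilocalQuadratic S g).re + μ * ∫ u : ℝ, ‖g u‖ ^ 2 := by
  have h := re_weilSemilocalQuadratic_erase_ge_of_two_certs hg hp hpS hsupp hm hcm hcert hcert'
  linarith

variable {P : (ℝ → ℂ) → Prop}

/-- **CONFINEMENT LAW (energy form).** For a unit test function in the window satisfying the constraint `P`:
`(μ − μ')·M_part(g) ≤ Re Q_{S∖p}(g) − (λ_min(S; c; P) − μ)` — the distance of `g`'s deleted Rayleigh quotient to the
Toeplitz floor `λ_min(S; c; P) − μ` controls the mass of `g` on the partial fibres. -/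
theorem partialMass_le_excess (hg : IsWeilTest g) {S : Finset ℕ} {p : ℕ} (hp : p.Prime) (hpS : p ∈ S)
    {c : ℝ} (hsupp : tsupport g ⊆ Icc (-c) c) (hPg : P g) (hn : ∫ u : ℝ, ‖g u‖ ^ 2 = 1) {m : ℕ}
    (hm : 2 * c < (m + 2) * Real.log p) (hcm : (m + 1) * Real.log p ≤ 2 * c) {μ μ' : ℝ}
    (hcert : (∀ G : ℤ → ℂ, (∀ k : ℤ, k < 0 → G k = 0) → (∀ k : ℤ, ((m + 1 : ℕ) : ℤ) < k → G k = 0) →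
      0 ≤ μ * ∑ i ∈ Finset.range (m + 2), ‖G i‖ ^ 2 +
        ∑ e ∈ Finset.range (m + 1), Real.log p / Real.sqrt ((p : ℝ) ^ (e + 1)) *
          ∑ i ∈ Finset.range (m + 2), (G i * conj (G ((i : ℤ) - (e + 1))) + G i * conj (G ((i : ℤ) + (e + 1)))).re))
    (hcert' : (∀ G : ℤ → ℂ, (∀ k : ℤ, k < 0 → G k = 0) → (∀ k : ℤ, ((m : ℕ) : ℤ) < k → G k = 0) →
      0 ≤ μ' * ∑ i ∈ Finset.range (m + 1), ‖G i‖ ^ 2 +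
        ∑ e ∈ Finset.range m, Real.log p / Real.sqrt ((p : ℝ) ^ (e + 1)) *
          ∑ i ∈ Finset.range (m + 1), (G i * conj (G ((i : ℤ) - (e + 1))) + G i * conj (G ((i : ℤ) + (e + 1)))).re)) :
    (μ - μ') * (∑ i ∈ Finset.range (m + 1),
        ∫ v in Ioo (c - (m + 1) * Real.log p) (-c + Real.log p), ‖g (v + i * Real.log p)‖ ^ 2) ≤
      (weilSemilocalQuadratic (S.erase p) g).re - (semilocalGroundEnergy S P c - μ) := by
  have h := partialMass_le_of_two_certs hg hp hpS hsupp hm hcm hcert hcert'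
  have h2 := semilocalGroundEnergy_le_re (S := S) hg hsupp hPg hn
  rw [hn, mul_one] at h
  linarith

/-- **CONFINEMENT OF NEAR-MINIMIZERS.** If the unit test function `g` (window `c`, constraint `P`) is an `η`-near-minimizer of
the deleted form, `Re Q_{S∖p}(g) ≤ λ_min(S∖p; c; P) + η`, then
`(μ − μ')·M_part(g) ≤ (λ_min(S∖p; c; P) − λ_min(S; c; P) + μ) + η` — the EXCESS of the deleted bottom over its Toeplitz floor,
plus `η`, bounds the leaked mass times the certificate gap.  (Lineage-E data: the leak term is 22–100 % of the excess.) -/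
theorem partialMass_le_of_near_minimizer (hg : IsWeilTest g) {S : Finset ℕ} {p : ℕ} (hp : p.Prime) (hpS : p ∈ S)
    {c : ℝ} (hsupp : tsupport g ⊆ Icc (-c) c) (hPg : P g) (hn : ∫ u : ℝ, ‖g u‖ ^ 2 = 1) {η : ℝ}
    (hnear : (weilSemilocalQuadratic (S.erase p) g).re ≤ semilocalGroundEnergy (S.erase p) P c + η) {m : ℕ}
    (hm : 2 * c < (m + 2) * Real.log p) (hcm : (m + 1) * Real.log p ≤ 2 * c) {μ μ' : ℝ}
    (hcert : (∀ G : ℤ → ℂ, (∀ k : ℤ, k < 0 → G k = 0) → (∀ k : ℤ, ((m + 1 : ℕ) : ℤ) < k → G k = 0) →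
      0 ≤ μ * ∑ i ∈ Finset.range (m + 2), ‖G i‖ ^ 2 +
        ∑ e ∈ Finset.range (m + 1), Real.log p / Real.sqrt ((p : ℝ) ^ (e + 1)) *
          ∑ i ∈ Finset.range (m + 2), (G i * conj (G ((i : ℤ) - (e + 1))) + G i * conj (G ((i : ℤ) + (e + 1)))).re))
    (hcert' : (∀ G : ℤ → ℂ, (∀ k : ℤ, k < 0 → G k = 0) → (∀ k : ℤ, ((m : ℕ) : ℤ) < k → G k = 0) →
      0 ≤ μ' * ∑ i ∈ Finset.range (m + 1), ‖G i‖ ^ 2 +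
        ∑ e ∈ Finset.range m, Real.log p / Real.sqrt ((p : ℝ) ^ (e + 1)) *
          ∑ i ∈ Finset.range (m + 1), (G i * conj (G ((i : ℤ) - (e + 1))) + G i * conj (G ((i : ℤ) + (e + 1)))).re)) :
    (μ - μ') * (∑ i ∈ Finset.range (m + 1),
        ∫ v in Ioo (c - (m + 1) * Real.log p) (-c + Real.log p), ‖g (v + i * Real.log p)‖ ^ 2) ≤
      (semilocalGroundEnergy (S.erase p) P c - semilocalGroundEnergy S P c + μ) + η := by
  have h := partialMass_le_excess hg hp hpS hsupp hPg hn hm hcm hcert hcert'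
  linarith

/-- **The leaked mass fraction is at most EXCESS/GAP.** Division form of `partialMass_le_of_near_minimizer` for an exact
minimizer (`η = 0`) when the certificate gap is positive. -/
theorem partialMass_le_excess_div_gap (hg : IsWeilTest g) {S : Finset ℕ} {p : ℕ} (hp : p.Prime) (hpS : p ∈ S)
    {c : ℝ} (hsupp : tsupport g ⊆ Icc (-c) c) (hPg : P g) (hn : ∫ u : ℝ, ‖g u‖ ^ 2 = 1)
    (hmin : (weilSemilocalQuadratic (S.erase p) g).re = semilocalGroundEnergy (S.erase p) P c) {m : ℕ}
    (hm : 2 * c < (m + 2) * Real.log p) (hcm : (m + 1) * Real.log p ≤ 2 * c) {μ μ' : ℝ} (hμ : μ' < μ)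
    (hcert : (∀ G : ℤ → ℂ, (∀ k : ℤ, k < 0 → G k = 0) → (∀ k : ℤ, ((m + 1 : ℕ) : ℤ) < k → G k = 0) →
      0 ≤ μ * ∑ i ∈ Finset.range (m + 2), ‖G i‖ ^ 2 +
        ∑ e ∈ Finset.range (m + 1), Real.log p / Real.sqrt ((p : ℝ) ^ (e + 1)) *
          ∑ i ∈ Finset.range (m + 2), (G i * conj (G ((i : ℤ) - (e + 1))) + G i * conj (G ((i : ℤ) + (e + 1)))).re))
    (hcert' : (∀ G : ℤ → ℂ, (∀ k : ℤ, k < 0 → G k = 0) → (∀ k : ℤ, ((m : ℕ) : ℤ) < k → G k = 0) →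
      0 ≤ μ' * ∑ i ∈ Finset.range (m + 1), ‖G i‖ ^ 2 +
        ∑ e ∈ Finset.range m, Real.log p / Real.sqrt ((p : ℝ) ^ (e + 1)) *
          ∑ i ∈ Finset.range (m + 1), (G i * conj (G ((i : ℤ) - (e + 1))) + G i * conj (G ((i : ℤ) + (e + 1)))).re)) :
    (∑ i ∈ Finset.range (m + 1),
        ∫ v in Ioo (c - (m + 1) * Real.log p) (-c + Real.log p), ‖g (v + i * Real.log p)‖ ^ 2) ≤
      (semilocalGroundEnergy (S.erase p) P c - semilocalGroundEnergy S P c + μ) / (μ - μ') := by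
  have h := partialMass_le_of_near_minimizer hg hp hpS hsupp hPg hn (η := 0) (by rw [hmin]; simp) hm hcm hcert hcert'
  rw [add_zero] at h
  rw [le_div_iff₀ (by linarith), mul_comm]
  exact h

end Summit.RiemannHypothesis.RiemannHypothesis.Theorems.SemilocalDeletionToeplitzConfinement

end
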